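import Summits.AtomisticToContinuum.BoseEinsteinCondensation.Theses.BECInsertionCorrector
import Summits.AtomisticToContinuum.BoseEinsteinCondensation.Theorems.StaticResponseBound.Negative.Basic
import Summits.AtomisticToContinuum.BoseEinsteinCondensation.Theorems.BECInsertionCorrectorStaticResponseBoundFreeSquare
import Summits.AtomisticToContinuum.BoseEinsteinCondensation.Theorems.BECInsertionCorrectorStaticResponseBoundThomsonReduction
import Summits.AtomisticToContinuum.BoseEinsteinCondensation.Theorems.BECInsertionCorrectorStaticResponseBoundModulationBootstrapOfExists
import Summits.AtomisticToContinuum.BoseEinsteinCondensation.Theorems.BECInsertionCorrectorStaticResponseBoundTruncationCompactness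
import Summits.AtomisticToContinuum.BoseEinsteinCondensation.Theorems.BECInsertionCorrectorStaticResponseBoundUvSusceptibilityEquiv
import Literature.MathematicalPhysics.QuantumManyBody.BoseGasStructureFactor
import Literature.MathematicalPhysics.QuantumManyBody.PeriodicBoseGasMomentumSector
import Literature.MathematicalPhysics.QuantumManyBody.PeriodicFormDomain
import Literature.MathematicalPhysics.QuantumManyBody.WeightedCorrector
import Literature.MathematicalPhysics.QuantumManyBody.PeriodicBoseGasScatteringODE
import HarnessLib

/-!
# The kinetic branch of the static response bound from the three ultraviolet stubs (glue for stub D)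

Helper file for the crux `BECInsertionCorrector.StaticResponseBound` (item stmt-AtomisticToContinuum-12057),
line `stable-fraction-square-completion`, registered sub-goal `kineticBranch_of_uvStubs` of the interface
stub **D** `stub_kineticBranch` (the KINETIC branch `|p|² > M₀² ρa` of the crux's inner inequality
`E₀ − C t² N / max(ρa, |p|²) ≤ ⟨Ψ, (H + t ∑ⱼ cos(p·xⱼ)) Ψ⟩`, `p = 2πk/L`, `L = (N/ρ)^{1/3}`).

Stub D is, verbatim, the statement `KineticBranch` delivered by the sibling line `uv-thomson-force-wave`
(skeleton `Cruxes/StaticResponseBound/Lines/uv-thomson-force-wave.lean`, lead -0), whose kernel-checked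
composition `kineticBranch_of : TruncationLimit → ModulationBootstrap → ThomsonReduction → UvForceWaveBound →
FreeSquare → KineticBranch` is sorry-free given its five hypotheses.  Of these, `ThomsonReduction` (S4) and
`FreeSquare` (S6) are landed theorems (`UvThomsonForceWave.stub_thomsonReduction`,
`UvThomsonForceWave.stub_freeSquare`), `TruncationLimit` (S2) is a landed theorem modulo the registered stub
`stub_maxFormBound` (`UvThomsonForceWave.truncationLimit_of_maxFormBound`), and `ModulationBootstrap` (S3) is a
landed theorem modulo the registered stub `stub_modulatedMinimiserExists`
(`UvThomsonForceWave.stub_modulationBootstrap_of_exists`).  This file records the resulting KERNEL GLUE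

  `kineticBranch_of_uvStubs : (stub_maxFormBound) → (stub_modulatedMinimiserExists) → (stub_uvForceWaveBound) → D`,

with the three hypotheses written out as the registered texts of those stubs and the conclusion written out as
the registered text of D, so that D follows by name once the three ultraviolet stubs land.  The proof is the
sibling composition (adapted from `Cruxes/StaticResponseBound/Lines/uv-thomson-force-wave.lean`, lead -0):
with `(Λ, ρ₁, K, n₀)` from the UV force-wave bound put `M₀ = √Λ`, `ρ₀ = ρ₁`, `C = C₁ + 1`, `C₁ = (1 + √K)²`.
For `N ≥ 1`, `k ≠ 0` in the window `Λρa ≤ |p|²` one has `max(ρa, |p|²) = |p|²`; if `|p|² E₀(v) ≤ C₁ N t²`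
the free square gives `E₀ − (C₁+1) t² N/|p|² ≤ −N t²/|p|² ≤ E_Ψ + t⟨∑cos⟩`; otherwise `N t² < |p|² E₀(v)`
with room `δ`, so `t² ≤ |p|² E₀(v_n)/N` for the truncations `v_n = min(v, n)` with `n` large
(`TruncationLimit`), every weakly modulated positive ground state of `v_n` has force wave `≤ K N` in `H₋₁`
(UV force-wave bound), hence centred susceptibility `≤ C₁ N/|p|²` (Thomson reduction), hence
`E₀(v_n) − (C₁ N/|p|²) t² ≤ E_{v_n}(Ψ) + t⟨∑cos⟩ ≤ E_v(Ψ) + t⟨∑cos⟩` (modulation bootstrap on the bounded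
`v_n`), and `E₀(v_n) → E₀(v)`.

Contents: one small helper (`kbglue_truncPotential_bounded`) and the glue theorem (the identity
`(√N + √(KN))² = (1+√K)² N` is `UvThomsonForceWave.sqrt_add_sqrt_mul_sq'`, monotonicity of the energy under
truncation is `UvThomsonForceWave.periodicEnergy_truncPotential_le'`).  No new definitions; the measure on
`ℝ/ℤ` is the Haar
probability measure through the local instances of `PeriodicFormDomain.lean` (exactly as in the landed
`Theorems/BECInsertionCorrectorStaticResponseBoundTruncationCompactness.lean`, so that the `MaxFormBound`
hypothesis is literally the hypothesis of `truncationLimit_of_maxFormBound`).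

References: the sibling skeleton and its landed files (above); [KipnisLandim1999, App. 1 §6] (the `H₋₁` norm),
B. Simon, J. Funct. Anal. 28 (1978) 377 (monotone convergence of forms), [Kato1966, VII §3].
-/

noncomputable section

namespace Summit.AtomisticToContinuum.BoseEinsteinCondensation.Cruxes.StaticResponseBound.StableFractionSquareCompletion

open MeasureTheory Filter UnitAddTorus
open scoped ENNReal NNReal BigOperators Topology InnerProductSpace ComplexConjugate
open Literature.MathematicalPhysics.QuantumManyBody.BoseGas
open Summit.AtomisticToContinuum.BoseEinsteinCondensation.Theses
open Summit.AtomisticToContinuum.BoseEinsteinCondensation.Theses.BECInsertionCorrector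
open Summit.AtomisticToContinuum.BoseEinsteinCondensation.Theorems.StaticResponseBound.Negative

-- The measure on `ℝ/ℤ` is the Haar PROBABILITY measure: file-local re-activation of the very instances
-- `PeriodicFormDomain.lean` declares locally (same convention as `PeriodicConfigFourier.lean` and the landed
-- `Theorems/BECInsertionCorrectorStaticResponseBoundTruncationCompactness.lean`).  REQUIRED: the registered text of
-- `stub_maxFormBound` (hypothesis 1 below) mentions `Lp ℂ 2 (volume : Measure (UnitAddTorus _))` and Mathlib's
-- `mFourierLp` (itself typed against this Haar `volume`); with these instances hypothesis 1 is literally the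
-- hypothesis `hcore` of `UvThomsonForceWave.truncationLimit_of_maxFormBound`.  Nothing else in the file uses them.
attribute [local instance] Literature.MathematicalPhysics.QuantumManyBody.BoseGas.formDomain_measureSpace
  Literature.MathematicalPhysics.QuantumManyBody.BoseGas.formDomain_isProbabilityMeasure
  Literature.MathematicalPhysics.QuantumManyBody.BoseGas.formDomain_isProbabilityMeasure_pi

/-! ## A small helper (adapted from Cruxes/StaticResponseBound/Lines/uv-thomson-force-wave.lean (lead -0)) -/

/-- The truncation `v_n = min(v, n)` is bounded (by `n < ⊤`). [folklore] -/
theorem kbglue_truncPotential_bounded (v : ℝ → ℝ≥0∞) (n : ℕ) :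
    ∃ M : ℝ≥0∞, M ≠ ⊤ ∧ ∀ r, truncPotential v n r ≤ M :=
  -- adapted from Cruxes/StaticResponseBound/Lines/uv-thomson-force-wave.lean (lead -0)
  ⟨n, ENNReal.natCast_ne_top n, fun r => truncPotential_le_nat v n r⟩

/-! ## The glue: stub D from the three ultraviolet stubs -/

/-- **Registered sub-goal `kineticBranch_of_uvStubs` of stub D `stub_kineticBranch`** (item
stmt-AtomisticToContinuum-12057, line `stable-fraction-square-completion`): the kinetic branch of the static
response bound — for every admissible `v` there are `M₀, ρ₀, C > 0` with
`E₀ − C t² N / max(ρa, |p|²) ≤ E_Ψ + t⟨∑ⱼcos(p·xⱼ)⟩_Ψ` for `0 < ρ < ρ₀`, `N ≥ 1`, `k ≠ 0` with `|p|² > M₀² ρa`,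
all `t` and all finite-energy periodic `Ψ` — FOLLOWS from the three registered ultraviolet stubs of the sibling
line `uv-thomson-force-wave`, taken here as hypotheses with their registered texts: (1) `stub_maxFormBound` (the
Bose-symmetric periodic `C¹` core realises the infimum of the maximal hard-core form), (2)
`stub_modulatedMinimiserExists` (positive real finite-energy `C¹` minimisers of `E_w + s⟨∑cos⟩` for bounded
admissible `w`), (3) `stub_uvForceWaveBound` (the `N`-uniform `H₋₁` bound `≤ K N` on the centred force-density
wave of the weakly modulated ground states of the truncations `v_n` on the UV window `Λρa ≤ |p|²`).  The proof is
the sibling's composition `kineticBranch_of` run with the landed `truncationLimit_of_maxFormBound`,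
`stub_modulationBootstrap_of_exists`, `stub_thomsonReduction`, `stub_freeSquare`; constants `M₀ = √Λ`,
`ρ₀ = ρ₁`, `C = (1 + √K)² + 1`. [folklore] -/
theorem kineticBranch_of_uvStubs :
    (∀ v : ℝ → ℝ≥0∞, IsRepulsiveFiniteRange v → ∀ (N : ℕ) (L : ℝ), 0 < L →
      ∀ η : Lp ℂ 2 (volume : Measure (UnitAddTorus (Fin N × Fin 3))), ‖η‖ = 1 →
        (∀ (σ : Equiv.Perm (Fin N)) (n : Fin N × Fin 3 → ℤ),
          ⟪(mFourierLp 2 (fun p : Fin N × Fin 3 => n (σ p.1, p.2)) :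
              Lp ℂ 2 (volume : Measure (UnitAddTorus (Fin N × Fin 3)))), η⟫_ℂ =
            ⟪(mFourierLp 2 n : Lp ℂ 2 (volume : Measure (UnitAddTorus (Fin N × Fin 3)))), η⟫_ℂ) →
        periodicGroundStateEnergy v N L ≤
          ∑' n : Fin N × Fin 3 → ℤ, ENNReal.ofReal (∑ p, (2 * Real.pi * (n p : ℝ) / L) ^ 2) *
              (‖⟪(mFourierLp 2 n : Lp ℂ 2 (volume : Measure (UnitAddTorus (Fin N × Fin 3)))), η⟫_ℂ‖₊ :
                ℝ≥0∞) ^ 2 +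
            ∫⁻ t, periodicInteraction v L (fromUnitTorusN L t) *
              (‖(η : UnitAddTorus (Fin N × Fin 3) → ℂ) t‖₊ : ℝ≥0∞) ^ 2) →
    (∀ w : ℝ → ℝ≥0∞, IsRepulsiveFiniteRange w → (∃ M : ℝ≥0∞, M ≠ ⊤ ∧ ∀ r, w r ≤ M) →
      ∀ (N : ℕ), 1 ≤ N → ∀ (L : ℝ), 0 < L → ∀ (k : Fin 3 → ℤ), k ≠ 0 → ∀ s : ℝ,
      ∃ Φ : PeriodicTrialState N L, (∀ X, Φ.ψ X = (‖Φ.ψ X‖ : ℂ)) ∧ (∀ X, Φ.ψ X ≠ 0) ∧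
        periodicEnergy w Φ ≠ ⊤ ∧
        ∀ Ψ : PeriodicTrialState N L, periodicEnergy w Ψ ≠ ⊤ →
          (periodicEnergy w Φ).toReal + s * cosMean L k Φ ≤
            (periodicEnergy w Ψ).toReal + s * cosMean L k Ψ) →
    (∀ v : ℝ → ℝ≥0∞, IsRepulsiveFiniteRange v →
      ∃ Λ : ℝ, 1 ≤ Λ ∧ ∃ ρ₁ : ℝ, 0 < ρ₁ ∧ ∃ K : ℝ, 0 ≤ K ∧ ∃ n₀ : ℕ, ∀ n : ℕ, n₀ ≤ n →
        ∀ ρ : ℝ, 0 < ρ → ρ < ρ₁ → ∀ N : ℕ, 1 ≤ N → ∀ k : Fin 3 → ℤ, k ≠ 0 →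
          Λ * (ρ * (scatteringLength v).toReal) ≤ psq (sideLength ρ N) k →
          ∀ s : ℝ, s ^ 2 ≤ psq (sideLength ρ N) k *
              (periodicGroundStateEnergy (truncPotential v n) N (sideLength ρ N)).toReal / N →
          ∀ Φ : PeriodicTrialState N (sideLength ρ N),
            (∀ X, Φ.ψ X = (‖Φ.ψ X‖ : ℂ)) → (∀ X, Φ.ψ X ≠ 0) →
            periodicEnergy (truncPotential v n) Φ ≠ ⊤ →
            (∀ Ψ : PeriodicTrialState N (sideLength ρ N), periodicEnergy (truncPotential v n) Ψ ≠ ⊤ →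
              (periodicEnergy (truncPotential v n) Φ).toReal + s * cosMean (sideLength ρ N) k Φ ≤
                (periodicEnergy (truncPotential v n) Ψ).toReal + s * cosMean (sideLength ρ N) k Ψ) →
            hMinusOneSqW (sideLength ρ N) (fun X => ‖Φ.ψ X‖)
                (fun X => ((∑ j : Fin N, Real.sin (2 * Real.pi / sideLength ρ N * ∑ i, (k i : ℝ) * X j i) *
              ∑ i : Fin 3, ((k i : ℝ) / Real.sqrt (∑ l, (k l : ℝ) ^ 2)) *
                pderiv j i (fun Y => ‖Φ.ψ Y‖ ^ 2) X) / ‖Φ.ψ X‖ ^ 2) -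
                  ∫ Y in cellN N (sideLength ρ N), ((∑ j : Fin N, Real.sin (2 * Real.pi / sideLength ρ N * ∑ i, (k i : ℝ) * Y j i) *
              ∑ i : Fin 3, ((k i : ℝ) / Real.sqrt (∑ l, (k l : ℝ) ^ 2)) *
                pderiv j i (fun Y => ‖Φ.ψ Y‖ ^ 2) Y) / ‖Φ.ψ Y‖ ^ 2) * ‖Φ.ψ Y‖ ^ 2)
              ≤ ENNReal.ofReal (K * N)) →
    ∀ v : ℝ → ℝ≥0∞, IsRepulsiveFiniteRange v →
      ∃ M₀ : ℝ, 0 < M₀ ∧ ∃ ρ₀ : ℝ, 0 < ρ₀ ∧ ∃ C : ℝ, 0 < C ∧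
        ∀ ρ : ℝ, 0 < ρ → ρ < ρ₀ → ∀ N : ℕ, 0 < N → ∀ k : Fin 3 → ℤ, k ≠ 0 →
          M₀ ^ 2 * (ρ * (scatteringLength v).toReal) < psq (sideLength ρ N) k →
          ∀ t : ℝ, ∀ Ψ : PeriodicTrialState N (sideLength ρ N), periodicEnergy v Ψ ≠ ⊤ →
            Ineq v C ρ N k t Ψ := by
  -- adapted from `kineticBranch_of`, Cruxes/StaticResponseBound/Lines/uv-thomson-force-wave.lean (lead -0)
  intro hMFB hF1 h₅ v hv
  -- S2 modulo MaxFormBound and S3 modulo (F1): the landed reductions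
  have h₂ := UvThomsonForceWave.truncationLimit_of_maxFormBound hMFB
  have h₃ := UvThomsonForceWave.stub_modulationBootstrap_of_exists hF1
  obtain ⟨Λ, hΛ, ρ₁, hρ₁, K, hK, n₀, hUV⟩ := h₅ v hv
  have hΛpos : 0 < Λ := lt_of_lt_of_le one_pos hΛ
  have hsK : 0 ≤ Real.sqrt K := Real.sqrt_nonneg K
  have hC₁ : 1 ≤ (1 + Real.sqrt K) ^ 2 := by nlinarith
  refine ⟨Real.sqrt Λ, Real.sqrt_pos.mpr hΛpos, ρ₁, hρ₁, (1 + Real.sqrt K) ^ 2 + 1, by linarith, ?_⟩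
  intro ρ hρ hρ1 N hNpos k hk hwin t Ψ hΨ
  rw [Real.sq_sqrt hΛpos.le] at hwin
  have hUVcase : Λ * (ρ * (scatteringLength v).toReal) ≤ psq (sideLength ρ N) k := hwin.le
  have hN1 : 1 ≤ N := hNpos
  have hNR : (0 : ℝ) < N := by exact_mod_cast hNpos
  have hL : 0 < sideLength ρ N := sideLength_pos hρ hNpos
  have hP : 0 < psq (sideLength ρ N) k := UvThomsonForceWave.freeSq_psq_pos hL hk
  have ha : 0 ≤ ρ * (scatteringLength v).toReal := mul_nonneg hρ.le ENNReal.toReal_nonneg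
  have hΛρa : ρ * (scatteringLength v).toReal ≤ Λ * (ρ * (scatteringLength v).toReal) :=
    le_mul_of_one_le_left ha hΛ
  unfold Ineq
  -- ultraviolet window: `max = |p|²`
  have hmax : max (ρ * (scatteringLength v).toReal) (psq (sideLength ρ N) k) = psq (sideLength ρ N) k :=
    max_eq_right (hΛρa.trans hUVcase)
  rw [hmax]
  have hfree := UvThomsonForceWave.stub_freeSquare v N (sideLength ρ N) hL k hk t Ψ hΨ
  have hsplit : ((1 + Real.sqrt K) ^ 2 + 1) * t ^ 2 * N / psq (sideLength ρ N) k =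
      (1 + Real.sqrt K) ^ 2 * t ^ 2 * N / psq (sideLength ρ N) k +
        (N : ℝ) * t ^ 2 / psq (sideLength ρ N) k := by
    ring
  rcases le_or_gt (psq (sideLength ρ N) k * (periodicGroundStateEnergy v N (sideLength ρ N)).toReal)
      ((1 + Real.sqrt K) ^ 2 * N * t ^ 2) with hA | hB
  · -- large coupling: the free square
    have hE0le : (periodicGroundStateEnergy v N (sideLength ρ N)).toReal ≤
        (1 + Real.sqrt K) ^ 2 * t ^ 2 * N / psq (sideLength ρ N) k := by
      rw [le_div_iff₀ hP]
      linarith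
    linarith
  · -- small coupling: bootstrap through the truncations
    have hE0fin : periodicGroundStateEnergy v N (sideLength ρ N) ≠ ⊤ :=
      ne_top_of_le_ne_top hΨ (periodicGroundStateEnergy_le v Ψ)
    -- room in the window
    set δ : ℝ := psq (sideLength ρ N) k * (periodicGroundStateEnergy v N (sideLength ρ N)).toReal -
      (N : ℝ) * t ^ 2 with hδ
    have hδpos : 0 < δ := by
      have : (N : ℝ) * t ^ 2 ≤ (1 + Real.sqrt K) ^ 2 * N * t ^ 2 := by
        have h0 : 0 ≤ (N : ℝ) * t ^ 2 := by positivity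
        nlinarith
      rw [hδ]
      linarith
    -- the core inequality with the constant `C₁`, up to an arbitrary `ε > 0`
    have hcore : ∀ ε : ℝ, 0 < ε →
        (periodicGroundStateEnergy v N (sideLength ρ N)).toReal -
            (1 + Real.sqrt K) ^ 2 * t ^ 2 * N / psq (sideLength ρ N) k ≤
          (periodicEnergy v Ψ).toReal + t * cosMean (sideLength ρ N) k Ψ + ε := by
      intro ε hε
      -- truncation height: large enough for S5 and for the S2-error `min ε (δ/|p|²)`
      have hε' : 0 < min ε (δ / psq (sideLength ρ N) k) := lt_min hε (div_pos hδpos hP)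
      obtain ⟨n₁, hn₁⟩ := h₂ v hv N (sideLength ρ N) hL hE0fin _ hε'
      set n := max n₀ n₁ with hn
      have hn0 : n₀ ≤ n := le_max_left _ _
      have hnn1 : n₁ ≤ n := le_max_right _ _
      have hS2 := hn₁ n hnn1
      have hminδ : min ε (δ / psq (sideLength ρ N) k) ≤ δ / psq (sideLength ρ N) k := min_le_right _ _
      have hminε : min ε (δ / psq (sideLength ρ N) k) ≤ ε := min_le_left _ _
      -- the window of S5 / S3 for the truncated problem contains `t`
      have hwin' : t ^ 2 ≤ psq (sideLength ρ N) k *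
          (periodicGroundStateEnergy (truncPotential v n) N (sideLength ρ N)).toReal / N := by
        rw [le_div_iff₀ hNR]
        have h1 : psq (sideLength ρ N) k * (δ / psq (sideLength ρ N) k) = δ := by
          field_simp
        have h2 : psq (sideLength ρ N) k * (periodicGroundStateEnergy v N (sideLength ρ N)).toReal ≤
            psq (sideLength ρ N) k *
                (periodicGroundStateEnergy (truncPotential v n) N (sideLength ρ N)).toReal +
              psq (sideLength ρ N) k * (δ / psq (sideLength ρ N) k) := by
          have := mul_le_mul_of_nonneg_left (hS2.trans (add_le_add le_rfl hminδ)) hP.le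
          linarith [this]
        rw [h1, hδ] at h2
        linarith
      -- S5 → S4: susceptibility of every weakly modulated ground state of `v_n`
      have hχ : ∀ s : ℝ, s ^ 2 ≤ psq (sideLength ρ N) k *
            (periodicGroundStateEnergy (truncPotential v n) N (sideLength ρ N)).toReal / N →
          ∀ Φ : PeriodicTrialState N (sideLength ρ N),
            (∀ X, Φ.ψ X = (‖Φ.ψ X‖ : ℂ)) → (∀ X, Φ.ψ X ≠ 0) →
            periodicEnergy (truncPotential v n) Φ ≠ ⊤ →
            (∀ Ψ' : PeriodicTrialState N (sideLength ρ N), periodicEnergy (truncPotential v n) Ψ' ≠ ⊤ →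
              (periodicEnergy (truncPotential v n) Φ).toReal + s * cosMean (sideLength ρ N) k Φ ≤
                (periodicEnergy (truncPotential v n) Ψ').toReal + s * cosMean (sideLength ρ N) k Ψ') →
            hMinusOneSqW (sideLength ρ N) (fun X => ‖Φ.ψ X‖)
                (fun X => (∑ j, Real.cos (2 * Real.pi / sideLength ρ N * ∑ i, (k i : ℝ) * X j i)) -
                  cosMean (sideLength ρ N) k Φ)
              ≤ ENNReal.ofReal ((1 + Real.sqrt K) ^ 2 * N / psq (sideLength ρ N) k) := by
        intro s hs Φ hreal hpos hfinΦ hmin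
        have hQ := hUV n hn0 ρ hρ hρ1 N hN1 k hk hUVcase s hs Φ hreal hpos hfinΦ hmin
        have hT := UvThomsonForceWave.stub_thomsonReduction N (sideLength ρ N) hL k hk Φ (K * N)
          (by positivity) hQ
        rwa [UvThomsonForceWave.sqrt_add_sqrt_mul_sq' K N] at hT
      -- S3 on the truncated problem: `v_n` is admissible (same range) and bounded
      have hvn : IsRepulsiveFiniteRange (truncPotential v n) :=
        ⟨measurable_truncPotential hv.1 n,
          hv.2.imp fun R₀ hR₀ r hr => truncPotential_eq_zero (hR₀ r hr) n⟩
      have hΨn : periodicEnergy (truncPotential v n) Ψ ≠ ⊤ :=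
        ne_top_of_le_ne_top hΨ (UvThomsonForceWave.periodicEnergy_truncPotential_le' v n Ψ)
      have hboot := h₃ (truncPotential v n) hvn (kbglue_truncPotential_bounded v n) N hN1
        (sideLength ρ N) hL k hk
        (psq (sideLength ρ N) k *
          (periodicGroundStateEnergy (truncPotential v n) N (sideLength ρ N)).toReal / N)
        ((1 + Real.sqrt K) ^ 2 * N / psq (sideLength ρ N) k)
        (by positivity) (by positivity) hχ t hwin' Ψ hΨn
      -- transfer energies from `v_n` to `v`
      have hEΨ : (periodicEnergy (truncPotential v n) Ψ).toReal ≤ (periodicEnergy v Ψ).toReal :=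
        ENNReal.toReal_mono hΨ (UvThomsonForceWave.periodicEnergy_truncPotential_le' v n Ψ)
      have hconst : (1 + Real.sqrt K) ^ 2 * N / psq (sideLength ρ N) k * t ^ 2 =
          (1 + Real.sqrt K) ^ 2 * t ^ 2 * N / psq (sideLength ρ N) k := by
        field_simp
      rw [hconst] at hboot
      linarith
    have hfinal : (periodicGroundStateEnergy v N (sideLength ρ N)).toReal -
          (1 + Real.sqrt K) ^ 2 * t ^ 2 * N / psq (sideLength ρ N) k ≤
        (periodicEnergy v Ψ).toReal + t * cosMean (sideLength ρ N) k Ψ :=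
      le_of_forall_pos_le_add hcore
    have hextra : 0 ≤ (N : ℝ) * t ^ 2 / psq (sideLength ρ N) k := by positivity
    linarith

end Summit.AtomisticToContinuum.BoseEinsteinCondensation.Cruxes.StaticResponseBound.StableFractionSquareCompletion

end
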